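import Mathlib.Data.Finset.Sort
import Literature.Analysis.FluidPDE.FiniteFourierModeEulerPolygonA

/-!
# Planar convex geometry of a face of `S^{conv}` seen from a vertex, II: the boundary polygon

Support file for `FiniteFourierModeEuler` (N. Kishimoto, T. Yoneda, J. Math. Fluid Mech. 24
(2022) 74 = arXiv:2110.08039), continuing `FiniteFourierModeEulerPolygonA`. For a face
`F = S ∩ {φ·x = M}` of `S^{conv}` (`φ·s ≤ M` on `S`, `M > 0`) containing the point `p₀` of maximal
length and two further points not collinear with it, we list "all vertices of `F` located in this
order" (proofs of Prop. 4.4 (iv) and Prop. 4.7): the extreme points of `conv F` other than `p₀`,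
sorted by slope around `p₀`, give `q₁, …, q_m` (`m ≥ 2`), and with `q₀ = q_{m+1} = p₀`:

* (`ORI`) `[p₀, q_i, q_j] > 0` for `1 ≤ i < j ≤ m` — the fan from `p₀` is positively oriented;
* (`EDGE`) for `0 ≤ j ≤ m` and every `s ∈ F`: `[q_j, q_{j+1}, s] ≥ 0`, with equality only for
  `s` on the segment `[q_j, q_{j+1}]` — each side is an edge of `S^{conv}`.

## References

* [KishimotoYoneda2022] N. Kishimoto, T. Yoneda, J. Math. Fluid Mech. 24 (2022) 74 =
  arXiv:2110.08039, §4 (vertices of a face "located in this order", Props. 4.4, 4.7).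
* [folklore] the boundary of a planar convex polygon.
-/

noncomputable section

open Matrix Set Finset

namespace Literature.Analysis.FluidPDE

namespace KY

open scoped Classical

/-- The data of a two-dimensional face of `S^{conv}` at the vertex `p₀` of maximal length:
`φ·s ≤ M` on `S` with `M > 0`, `φ·p₀ = M`, `p₀` strictly exposed by `x ↦ p₀·x`, and two points of
the face not collinear with `p₀`. [cite: KishimotoYoneda2022, §4 Prop. 4.4 (faces of `S^{conv}`)] -/
structure FaceCfg (S : Finset (Fin 3 → ℝ)) (φ p₀ : Fin 3 → ℝ) (M : ℝ) : Prop where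
  hM : 0 < M
  hmax : ∀ s ∈ S, s ⬝ᵥ φ ≤ M
  hp₀ : p₀ ∈ S
  hpM : p₀ ⬝ᵥ φ = M
  hfar : ∀ s ∈ S, s ≠ p₀ → p₀ ⬝ᵥ s < p₀ ⬝ᵥ p₀
  h2 : ∃ a ∈ S, ∃ b ∈ S, a ⬝ᵥ φ = M ∧ b ⬝ᵥ φ = M ∧ p₀ ⬝ᵥ (a ⨯₃ b) ≠ 0

/-- The points of `S` on the face. [folklore] -/
def face (S : Finset (Fin 3 → ℝ)) (φ : Fin 3 → ℝ) (M : ℝ) : Finset (Fin 3 → ℝ) :=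
  S.filter fun s => s ⬝ᵥ φ = M

/-- The vertices of the face other than `p₀`: extreme points of `conv(face)` distinct from `p₀`. [folklore] -/
def verts (S : Finset (Fin 3 → ℝ)) (φ p₀ : Fin 3 → ℝ) (M : ℝ) : Finset (Fin 3 → ℝ) :=
  ((face S φ M).filter fun s =>
    s ∈ (convexHull ℝ ((face S φ M : Finset (Fin 3 → ℝ)) : Set (Fin 3 → ℝ))).extremePoints ℝ).erase p₀

namespace FaceCfg

variable {S : Finset (Fin 3 → ℝ)} {φ p₀ : Fin 3 → ℝ} {M : ℝ} (h : FaceCfg S φ p₀ M)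
include h

omit h in
/-- Membership in the face. [folklore] -/
theorem mem_face {s : Fin 3 → ℝ} : s ∈ face S φ M ↔ s ∈ S ∧ s ⬝ᵥ φ = M := Finset.mem_filter

/-- `p₀` lies on the face. [folklore] -/
theorem p₀_mem_face : p₀ ∈ face S φ M := Finset.mem_filter.2 ⟨h.hp₀, h.hpM⟩

/-- `p₀ × φ ≠ 0`: otherwise the face would reduce to `{p₀}`. [folklore] -/
theorem hω : p₀ ⨯₃ φ ≠ 0 := by
  intro h0
  obtain ⟨a, ha, b, hb, haM, hbM, hab⟩ := h.h2
  have hp0 : p₀ ≠ 0 := by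
    intro hp; have := h.hpM; rw [hp, zero_dotProduct] at this; exact h.hM.ne' this.symm
  -- `φ = c p₀`
  have hφ : φ = ((p₀ ⬝ᵥ φ) / (p₀ ⬝ᵥ p₀)) • p₀ := by
    have := eq_smul_of_cross_eq_zero hp0 (u := φ) (by rw [← cross_anticomm, h0, neg_zero])
    simpa [dotProduct_comm] using this
  have hρ : p₀ ⬝ᵥ p₀ ≠ 0 := fun h' => hp0 (dotProduct_self_eq_zero.1 h')
  -- every face point equals `p₀`
  have key : ∀ s ∈ S, s ⬝ᵥ φ = M → s = p₀ := by
    intro s hs hsM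
    by_contra hne
    have h1 := h.hfar s hs hne
    have h2 : s ⬝ᵥ φ = (p₀ ⬝ᵥ φ) / (p₀ ⬝ᵥ p₀) * (s ⬝ᵥ p₀) := by
      conv_lhs => rw [hφ]
      rw [dotProduct_smul, smul_eq_mul]
    rw [hsM, h.hpM, dotProduct_comm s p₀] at h2
    have h3 : M * (p₀ ⬝ᵥ p₀) = M * (p₀ ⬝ᵥ s) := by
      field_simp at h2; linarith
    have h4 := mul_left_cancel₀ h.hM.ne' h3
    linarith
  rw [key a ha haM, key b hb hbM] at hab
  exact hab (by simp)

omit h in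
/-- Vertices are face points distinct from `p₀` and extreme in `conv(face)`. [folklore] -/
theorem mem_verts {v : Fin 3 → ℝ} :
    v ∈ verts S φ p₀ M ↔ v ≠ p₀ ∧ v ∈ face S φ M ∧
      v ∈ (convexHull ℝ ((face S φ M : Finset (Fin 3 → ℝ)) : Set (Fin 3 → ℝ))).extremePoints ℝ := by
  unfold verts; rw [Finset.mem_erase, Finset.mem_filter]

/-- Vertices have positive depth below `p₀`. [folklore] -/
theorem verts_depth_pos {v : Fin 3 → ℝ} (hv : v ∈ verts S φ p₀ M) : 0 < depth p₀ v := by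
  rw [mem_verts] at hv
  exact depth_pos h.hfar (Finset.mem_filter.1 hv.2.1).1 hv.1

omit h in
/-- Vertices lie on the supporting plane. [folklore] -/
theorem verts_plane {v : Fin 3 → ℝ} (hv : v ∈ verts S φ p₀ M) : v ⬝ᵥ φ = M := by
  rw [mem_verts] at hv; exact (Finset.mem_filter.1 hv.2.1).2

/-- `p₀` is a vertex (extreme point) of `conv(face)`. [folklore] -/
theorem p₀_extreme : p₀ ∈ (convexHull ℝ ((face S φ M : Finset (Fin 3 → ℝ)) : Set (Fin 3 → ℝ))).extremePoints ℝ :=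
  mem_extremePoints_of_exposed h.p₀_mem_face fun s hs hne => h.hfar s (Finset.mem_filter.1 hs).1 hne

omit h in
/-- An extreme point of `conv(face)` on an open segment with endpoints in the face equals both
endpoints. [folklore] -/
theorem eq_of_extreme_of_mem_openSegment {x a b : Fin 3 → ℝ}
    (hx : x ∈ (convexHull ℝ ((face S φ M : Finset (Fin 3 → ℝ)) : Set (Fin 3 → ℝ))).extremePoints ℝ)
    (ha : a ∈ face S φ M) (hb : b ∈ face S φ M) (hseg : x ∈ openSegment ℝ a b) : a = x ∧ b = x := by
  rw [mem_extremePoints] at hx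
  exact hx.2 a (subset_convexHull _ _ (Finset.mem_coe.2 ha)) b (subset_convexHull _ _ (Finset.mem_coe.2 hb)) hseg

omit h in
/-- Parametrised points of the line through `a ≠ b` off the closed segment put `a` or `b` on an
open segment. [folklore] -/
theorem openSegment_of_param {a b s : Fin 3 → ℝ} {θ : ℝ} (hs : s = a + θ • (b - a)) :
    (θ < 0 → a ∈ openSegment ℝ s b) ∧ (1 < θ → b ∈ openSegment ℝ a s) := by
  constructor
  · intro hθ
    refine ⟨1 / (1 - θ), -θ / (1 - θ), by apply div_pos one_pos; linarith,
      by apply div_pos (by linarith) (by linarith),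
      by rw [← add_div, show (1 : ℝ) + -θ = 1 - θ by ring, div_self (by linarith)], ?_⟩
    rw [hs]
    have h1 : (1 - θ) ≠ 0 := by linarith
    ext i; simp only [Pi.add_apply, Pi.smul_apply, Pi.sub_apply, smul_eq_mul]; field_simp; ring
  · intro hθ
    have hθ0 : θ ≠ 0 := by linarith
    refine ⟨1 - 1 / θ, 1 / θ, by rw [sub_pos, div_lt_one (by linarith)]; exact hθ,
      by apply div_pos one_pos; linarith, by ring, ?_⟩
    rw [hs]
    ext i; simp only [Pi.add_apply, Pi.smul_apply, Pi.sub_apply, smul_eq_mul]; field_simp; ring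

/-- The slope is injective on the vertices. [folklore] -/
theorem slope_injOn : Set.InjOn (slope φ p₀) (verts S φ p₀ M : Set (Fin 3 → ℝ)) := by
  intro x hx y hy hxy
  rw [Finset.mem_coe] at hx hy
  by_contra hne
  have h0 : p₀ ⬝ᵥ (x ⨯₃ y) = 0 :=
    (triple_eq_zero_iff_slope_eq h.hω h.hM h.hpM (verts_plane hx) (verts_plane hy)
      (h.verts_depth_pos hx) (h.verts_depth_pos hy)).2 hxy
  have hxp : x ≠ p₀ := ((mem_verts).1 hx).1
  have hyp : y ≠ p₀ := ((mem_verts).1 hy).1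
  obtain ⟨θ, hθ⟩ := exists_param_of_triple_eq_zero (φ := φ) (M := M) h.hM.ne'
    (by rw [dotProduct_comm]; exact h.hpM) (by rw [dotProduct_comm]; exact verts_plane hx)
    (by rw [dotProduct_comm]; exact verts_plane hy) (Ne.symm hxp) h0
  have hxF : x ∈ face S φ M := ((mem_verts).1 hx).2.1
  have hyF : y ∈ face S φ M := ((mem_verts).1 hy).2.1
  have hxE := ((mem_verts).1 hx).2.2
  have hyE := ((mem_verts).1 hy).2.2
  obtain ⟨hneg, hbig⟩ := openSegment_of_param hθ
  rcases lt_trichotomy θ 0 with hlt | heq | hgt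
  · -- `p₀ ∈ (y, x)`
    have := (eq_of_extreme_of_mem_openSegment h.p₀_extreme hyF hxF (hneg hlt)).2
    exact hxp this
  · rw [heq, zero_smul, add_zero] at hθ; exact hyp hθ
  · rcases lt_trichotomy θ 1 with hlt1 | heq1 | hgt1
    · -- `y ∈ (p₀, x)`
      have hseg : y ∈ openSegment ℝ p₀ x := ⟨1 - θ, θ, by linarith, hgt, by ring, by rw [hθ]; ext i; simp; ring⟩
      exact hyp (eq_of_extreme_of_mem_openSegment hyE h.p₀_mem_face hxF hseg).1.symm
    · rw [heq1, one_smul] at hθ; exact hne (by rw [hθ]; abel)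
    · -- `x ∈ (p₀, y)`
      have := (eq_of_extreme_of_mem_openSegment hxE h.p₀_mem_face hyF (hbig hgt1)).1
      exact hxp this.symm

/-! ### The sorted vertex cycle -/

/-- The slopes of the vertices. [folklore] -/
def keys (S : Finset (Fin 3 → ℝ)) (φ p₀ : Fin 3 → ℝ) (M : ℝ) : Finset ℝ :=
  (verts S φ p₀ M).image (slope φ p₀)

/-- The number `m` of vertices of the face other than `p₀`. [folklore] -/
def nverts (S : Finset (Fin 3 → ℝ)) (φ p₀ : Fin 3 → ℝ) (M : ℝ) : ℕ := (keys S φ p₀ M).card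

/-- The `i`-th smallest slope. [folklore] -/
def keyOf (S : Finset (Fin 3 → ℝ)) (φ p₀ : Fin 3 → ℝ) (M : ℝ) (i : Fin (nverts S φ p₀ M)) : ℝ :=
  (keys S φ p₀ M).orderEmbOfFin rfl i

/-- The vertex with the `i`-th smallest slope. [folklore] -/
def vertexAt (S : Finset (Fin 3 → ℝ)) (φ p₀ : Fin 3 → ℝ) (M : ℝ) (i : Fin (nverts S φ p₀ M)) :
    Fin 3 → ℝ :=
  if hx : ∃ v ∈ verts S φ p₀ M, slope φ p₀ v = keyOf S φ p₀ M i then hx.choose else p₀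

/-- **The boundary polygon of the face**: `q₀ = p₀`, `q₁, …, q_m` the vertices by increasing slope,
`q_j = p₀` for `j > m`. [cite: KishimotoYoneda2022, §4 (vertices of a face "located in this order")] -/
def poly (S : Finset (Fin 3 → ℝ)) (φ p₀ : Fin 3 → ℝ) (M : ℝ) (j : ℕ) : Fin 3 → ℝ :=
  if hj : 1 ≤ j ∧ j ≤ nverts S φ p₀ M then vertexAt S φ p₀ M ⟨j - 1, by omega⟩ else p₀

omit h in
/-- `q₀ = p₀`. [folklore] -/
theorem poly_zero : poly S φ p₀ M 0 = p₀ := by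
  unfold poly; simp

omit h in
/-- `q_j = p₀` for `j > m`. [folklore] -/
theorem poly_of_gt {j : ℕ} (hj : nverts S φ p₀ M < j) : poly S φ p₀ M j = p₀ := by
  unfold poly; rw [dif_neg]; omega

omit h in
/-- The `i`-th vertex is a vertex with the `i`-th slope. [folklore] -/
theorem vertexAt_spec (i : Fin (nverts S φ p₀ M)) :
    vertexAt S φ p₀ M i ∈ verts S φ p₀ M ∧ slope φ p₀ (vertexAt S φ p₀ M i) = keyOf S φ p₀ M i := by
  have hmem : keyOf S φ p₀ M i ∈ keys S φ p₀ M := Finset.orderEmbOfFin_mem _ _ i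
  unfold keys at hmem
  rw [Finset.mem_image] at hmem
  have hx : ∃ v ∈ verts S φ p₀ M, slope φ p₀ v = keyOf S φ p₀ M i := hmem
  unfold vertexAt
  rw [dif_pos hx]
  exact hx.choose_spec

omit h in
/-- `q_j` (`1 ≤ j ≤ m`) is the vertex with the `(j-1)`-st smallest slope. [folklore] -/
theorem poly_spec {j : ℕ} (hj1 : 1 ≤ j) (hj2 : j ≤ nverts S φ p₀ M) :
    poly S φ p₀ M j ∈ verts S φ p₀ M ∧
      slope φ p₀ (poly S φ p₀ M j) = keyOf S φ p₀ M ⟨j - 1, by omega⟩ := by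
  unfold poly
  rw [dif_pos ⟨hj1, hj2⟩]
  exact vertexAt_spec _

omit h in
/-- `q_j ∈ verts` for `1 ≤ j ≤ m`. [folklore] -/
theorem poly_mem_verts {j : ℕ} (hj1 : 1 ≤ j) (hj2 : j ≤ nverts S φ p₀ M) :
    poly S φ p₀ M j ∈ verts S φ p₀ M := (poly_spec hj1 hj2).1

omit h in
/-- `q_j` lies on the face for `1 ≤ j ≤ m`. [folklore] -/
theorem poly_mem_face {j : ℕ} (hj1 : 1 ≤ j) (hj2 : j ≤ nverts S φ p₀ M) :
    poly S φ p₀ M j ∈ face S φ M := ((mem_verts).1 (poly_mem_verts hj1 hj2)).2.1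

omit h in
/-- The slopes are listed increasingly. [folklore] -/
theorem keyOf_strictMono : StrictMono (keyOf S φ p₀ M) := fun _ _ hij =>
  ((keys S φ p₀ M).orderEmbOfFin rfl).strictMono hij

omit h in
/-- Every slope of a vertex is some `keyOf`. [folklore] -/
theorem exists_keyOf_eq {v : Fin 3 → ℝ} (hv : v ∈ verts S φ p₀ M) :
    ∃ i : Fin (nverts S φ p₀ M), keyOf S φ p₀ M i = slope φ p₀ v := by
  have hmem : slope φ p₀ v ∈ (keys S φ p₀ M : Set ℝ) := by
    rw [Finset.mem_coe]; unfold keys; exact Finset.mem_image_of_mem _ hv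
  rw [← Finset.range_orderEmbOfFin (keys S φ p₀ M) rfl] at hmem
  obtain ⟨i, hi⟩ := hmem
  exact ⟨i, hi⟩

omit h in
/-- **(ORI)** slopes increase strictly along the polygon. [folklore] -/
theorem slope_poly_lt {i j : ℕ} (hi : 1 ≤ i) (hij : i < j) (hj : j ≤ nverts S φ p₀ M) :
    slope φ p₀ (poly S φ p₀ M i) < slope φ p₀ (poly S φ p₀ M j) := by
  have hi' : i ≤ nverts S φ p₀ M := by omega
  have hj' : 1 ≤ j := by omega
  rw [(poly_spec hi hi').2, (poly_spec hj' hj).2]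
  apply keyOf_strictMono
  rw [Fin.mk_lt_mk]; omega

/-- **(ORI)** the fan from `p₀` is positively oriented: `[p₀, q_i, q_j] > 0` for `1 ≤ i < j ≤ m`.
[cite: KishimotoYoneda2022, §4 Lemma 4.6 ("the ordering is eastward")] -/
theorem triple_poly_pos {i j : ℕ} (hi : 1 ≤ i) (hij : i < j) (hj : j ≤ nverts S φ p₀ M) :
    0 < p₀ ⬝ᵥ (poly S φ p₀ M i ⨯₃ poly S φ p₀ M j) := by
  have hi' : i ≤ nverts S φ p₀ M := by omega
  have hj' : 1 ≤ j := by omega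
  have hvi := poly_mem_verts hi hi'
  have hvj := poly_mem_verts hj' hj
  exact (triple_pos_iff_slope_lt h.hω h.hM h.hpM (verts_plane hvi) (verts_plane hvj)
    (h.verts_depth_pos hvi) (h.verts_depth_pos hvj)).2 (slope_poly_lt hi hij hj)

omit h in
/-- No vertex has slope strictly between two consecutive polygon vertices. [folklore] -/
theorem not_slope_between {j : ℕ} (hj1 : 1 ≤ j) (hj2 : j + 1 ≤ nverts S φ p₀ M) {v : Fin 3 → ℝ}
    (hv : v ∈ verts S φ p₀ M) (h1 : slope φ p₀ (poly S φ p₀ M j) < slope φ p₀ v)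
    (h2 : slope φ p₀ v < slope φ p₀ (poly S φ p₀ M (j + 1))) : False := by
  obtain ⟨i, hi⟩ := exists_keyOf_eq hv
  have hj1' : j ≤ nverts S φ p₀ M := by omega
  have hj2' : 1 ≤ j + 1 := by omega
  rw [← hi, (poly_spec hj1 hj1').2] at h1
  rw [← hi, (poly_spec hj2' hj2).2] at h2
  have k1 := (keyOf_strictMono (S := S) (φ := φ) (p₀ := p₀) (M := M)).lt_iff_lt.1 h1
  have k2 := (keyOf_strictMono (S := S) (φ := φ) (p₀ := p₀) (M := M)).lt_iff_lt.1 h2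
  rw [Fin.lt_def] at k1 k2
  dsimp at k1 k2
  omega

omit h in
/-- The first polygon vertex has the smallest slope. [folklore] -/
theorem slope_poly_one_le {v : Fin 3 → ℝ} (hv : v ∈ verts S φ p₀ M) (hm : 1 ≤ nverts S φ p₀ M) :
    slope φ p₀ (poly S φ p₀ M 1) ≤ slope φ p₀ v := by
  obtain ⟨i, hi⟩ := exists_keyOf_eq hv
  rw [← hi, (poly_spec le_rfl hm).2]
  apply (keyOf_strictMono (S := S) (φ := φ) (p₀ := p₀) (M := M)).monotone
  rw [Fin.le_def]; dsimp; omega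

omit h in
/-- The last polygon vertex has the largest slope. [folklore] -/
theorem slope_le_poly_last {v : Fin 3 → ℝ} (hv : v ∈ verts S φ p₀ M) (hm : 1 ≤ nverts S φ p₀ M) :
    slope φ p₀ v ≤ slope φ p₀ (poly S φ p₀ M (nverts S φ p₀ M)) := by
  obtain ⟨i, hi⟩ := exists_keyOf_eq hv
  rw [← hi, (poly_spec hm le_rfl).2]
  apply (keyOf_strictMono (S := S) (φ := φ) (p₀ := p₀) (M := M)).monotone
  rw [Fin.le_def]; dsimp; have := i.2; omega

omit h in
/-- All extreme points of `conv(face)` are `p₀` or polygon vertices; hence the face lies in the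
convex hull of `{p₀} ∪ verts`. [folklore] -/
theorem face_subset_convexHull :
    ((face S φ M : Finset (Fin 3 → ℝ)) : Set (Fin 3 → ℝ))
      ⊆ convexHull ℝ (insert p₀ ((verts S φ p₀ M : Finset (Fin 3 → ℝ)) : Set (Fin 3 → ℝ))) := by
  refine face_subset_convexHull_extremePoints.trans (convexHull_mono ?_)
  intro v hv
  by_cases hvp : v = p₀
  · exact Or.inl hvp
  · right
    rw [Finset.mem_coe, mem_verts]
    exact ⟨hvp, extremePoints_subset_face hv, hv⟩

/-- **The face is two-dimensional: `m ≥ 2`.** [folklore] -/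
theorem two_le_nverts : 2 ≤ nverts S φ p₀ M := by
  by_contra hlt
  rw [not_le] at hlt
  obtain ⟨a, ha, b, hb, haM, hbM, hab⟩ := h.h2
  have haF : a ∈ face S φ M := Finset.mem_filter.2 ⟨ha, haM⟩
  have hbF : b ∈ face S φ M := Finset.mem_filter.2 ⟨hb, hbM⟩
  -- `verts ⊆ {w}` for some `w`
  have hcard : (verts S φ p₀ M).card ≤ 1 := by
    have : (verts S φ p₀ M).card = nverts S φ p₀ M := by
      unfold nverts keys; rw [Finset.card_image_of_injOn h.slope_injOn]
    omega
  -- all face points are combinations of `p₀` and one vertex `w` (or of `p₀` alone)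
  have key : ∃ w : Fin 3 → ℝ, ((face S φ M : Finset (Fin 3 → ℝ)) : Set (Fin 3 → ℝ))
      ⊆ convexHull ℝ {p₀, w} := by
    rcases (verts S φ p₀ M).eq_empty_or_nonempty with he | ⟨w, hw⟩
    · refine ⟨p₀, (face_subset_convexHull (p₀ := p₀)).trans (convexHull_mono ?_)⟩
      rw [he]; simp
    · refine ⟨w, (face_subset_convexHull (p₀ := p₀)).trans (convexHull_mono ?_)⟩
      intro v hv
      rcases hv with hv | hv
      · exact Or.inl hv
      · right
        rw [Finset.mem_coe] at hv
        exact Finset.card_le_one.1 hcard v hv w hw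
  obtain ⟨w, hw⟩ := key
  rw [convexHull_pair] at hw
  obtain ⟨α, β, -, -, -, hcomb⟩ := hw (Finset.mem_coe.2 haF)
  obtain ⟨γ, δ, -, -, -, hcomb'⟩ := hw (Finset.mem_coe.2 hbF)
  apply hab
  rw [← hcomb, ← hcomb']
  simp only [map_add, map_smul, LinearMap.add_apply, LinearMap.smul_apply, cross_self, smul_zero,
    zero_add, add_zero, dotProduct_add, dotProduct_smul, dot_self_cross, smul_eq_mul, mul_zero]
  rw [← cross_anticomm p₀ w, dotProduct_neg, dot_self_cross]; ring

end FaceCfg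

end KY

end Literature.Analysis.FluidPDE
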